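import Literature.MathematicalPhysics.QuantumManyBody.StateRelaxationDuality
import Literature.MathematicalPhysics.QuantumLattice.HubbardOneParticleCost
import HarnessLib

/-!
# Bootstrap / SOS dual certificates for the sector ground energy of the Hubbard model

Family `hubbard` (trunk T-QLATTICE). The five-line glue between the abstract weak-duality lemma
`Literature.MathematicalPhysics.QuantumManyBody.StateRelaxation.eigenvalue_ge_of_certificate` and
the tree's canonical sector energy `groundEnergyAt G t U N = HubbardWave0.groundEnergy (hamiltonian
G t U) N` (all `S^z`, particle number `N`): an operator identity on the fermionic Fock space
`Matrix (Finset (Orb Λ)) (Finset (Orb Λ)) ℂ`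

`H − c·1 = Σᵢⱼ Λᵢⱼ Oᵢᴴ Oⱼ + Σₖ (H Xₖ − Xₖ H) + Σₗ (Yₗ (N̂ − N) + (N̂ − N) Y'ₗ)`, `Λ ⪰ 0`,

certifies `c ≤ groundEnergyAt G t U N` for every `N ≤ 2|Λ|` (`groundEnergyAt_ge_of_certificate`):
the identity is evaluated in a normalised sector ground state (an `H`-eigenvector,
`ThermodynamicLimit.exists_unit_groundState`), which kills the commutators (energy eigenstate,
Han 2020's `⟨[H,O]⟩ = 0`) and the particle-number ideal (`N̂ − N` annihilates the sector,
`totalNumberOp_sub_mulVec_of_isNParticle`; the weighted-SOS ideal terms `r f + f† r`,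
`r = N̂ − η`, of Rubin–Low–DePrince 2026 §III.A). This is the statement shape in which finite-torus
certificates for `hubbardTorus 2 L t U` (`G = fermionTorusGraph 2 L`) enter the tree; the
positive-semidefiniteness of a literal rational `Λ` is discharged by
`Literature.Analysis.ValidatedNumerics.PSDCert` and the identity by normal ordering.
Everything is PROVED; no named fact is introduced.

## References
* X. Han, *Quantum many-body bootstrap*, arXiv:2006.06002 (2020), §2–3. [cite: Han2020Bootstrap, §2]
* N. C. Rubin, G. H. Low, A. E. DePrince III, arXiv:2602.05069 (2026), §III.A (Hubbard SOS with the
  particle-number ideal). [cite: RubinLowDePrince2026, §III.A]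
* J. S. M. Anderson, M. Nakata, R. Igarashi, K. Fujisawa, M. Yamashita, Comput. Theor. Chem. 1003
  (2013) 22 (v2RDM lower bounds for the `4 × 4` Hubbard torus). [cite: AndersonNakataEtAl2013]
-/

noncomputable section

namespace Literature.MathematicalPhysics.QuantumLattice

open Matrix Finset HubbardWave0 Literature.MathematicalPhysics.QuantumManyBody.StateRelaxation
open scoped ComplexOrder BigOperators

section NumberIdeal

variable {ι : Type*} [LinearOrder ι] [Fintype ι]

/-- The particle-number constraint operator `N̂ − N·1` annihilates the `N`-particle sector
(`N̂` is diagonal with entry `#s` on `|s⟩`). Tasaki (2020) §9.2. [cite: Tasaki2020, §9.2] -/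
theorem totalNumberOp_sub_mulVec_of_isNParticle (N : ℕ) {ψ : Fock ι} (hψ : IsNParticle N ψ) :
    (totalNumberOp - (N : ℂ) • (1 : Matrix (Finset ι) (Finset ι) ℂ)) *ᵥ ψ = 0 := by
  rw [totalNumberOp_eq_diagonal, sub_mulVec, smul_mulVec, one_mulVec]
  funext s
  rw [Pi.sub_apply, mulVec_diagonal, Pi.smul_apply, Pi.zero_apply, smul_eq_mul]
  by_cases hs : s.card = N
  · rw [hs, sub_self]
  · rw [hψ s hs, mul_zero, mul_zero, sub_self]

/-- `N̂ − N·1` is Hermitian. Tasaki (2020) §9.2. [cite: Tasaki2020, §9.2] -/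
theorem conjTranspose_totalNumberOp_sub (N : ℕ) :
    (totalNumberOp - (N : ℂ) • (1 : Matrix (Finset ι) (Finset ι) ℂ))ᴴ =
      totalNumberOp - (N : ℂ) • (1 : Matrix (Finset ι) (Finset ι) ℂ) := by
  rw [conjTranspose_sub, conjTranspose_smul, conjTranspose_one, totalNumberOp_eq_diagonal,
    diagonal_conjTranspose]
  congr 1
  · congr 1
    funext s
    simp
  · rw [Complex.star_def, Complex.conj_natCast]

end NumberIdeal

section Certificate

variable {Λ : Type*} [LinearOrder Λ] [Fintype Λ] (G : SimpleGraph Λ) [DecidableRel G.Adj]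

/-- **Bootstrap / SOS certificate for the Hubbard sector ground energy.** For `N ≤ 2|Λ|`, an
identity `H − c·1 = Σᵢⱼ Λᵢⱼ Oᵢᴴ Oⱼ + Σₖ (H Xₖ − Xₖ H) + Σₗ (Yₗ (N̂ − N) + (N̂ − N) Y'ₗ)` with
`Λ ⪰ 0` (`H = hamiltonian G t U`, `N̂ = totalNumberOp`) proves `c ≤ groundEnergyAt G t U N`.
Han 2020 §2 eq. (2)–(3) (constraints `⟨[H,O]⟩ = 0`, `⟨[N,O]⟩ = 0`, positivity) in dual form;
Rubin–Low–DePrince 2026 §III.A (particle-number ideal). [cite: Han2020Bootstrap, §2 eq. (3)] -/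
theorem groundEnergyAt_ge_of_certificate (t U : ℝ) {N : ℕ} (hN : N ≤ 2 * Fintype.card Λ)
    {m : Type*} [Fintype m] [DecidableEq m] {Λm : Matrix m m ℂ} (hΛ : Λm.PosSemidef)
    (O : m → Matrix (Finset (Orb Λ)) (Finset (Orb Λ)) ℂ)
    {κ : Type*} (s : Finset κ) (X : κ → Matrix (Finset (Orb Λ)) (Finset (Orb Λ)) ℂ)
    {κ' : Type*} (s' : Finset κ') (Y Y' : κ' → Matrix (Finset (Orb Λ)) (Finset (Orb Λ)) ℂ)
    {c : ℝ}
    (hcert : hamiltonian G t U - (c : ℂ) • (1 : Matrix (Finset (Orb Λ)) (Finset (Orb Λ)) ℂ) =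
      gramForm Λm O + (∑ k ∈ s, (hamiltonian G t U * X k - X k * hamiltonian G t U) +
        ∑ l ∈ s', (Y l * (totalNumberOp - (N : ℂ) • 1) + (totalNumberOp - (N : ℂ) • 1) * Y' l))) :
    c ≤ groundEnergyAt G t U N := by
  obtain ⟨ψ, hψN, hψ1, hHψ⟩ := ThermodynamicLimit.exists_unit_groundState G t U hN
  exact eigenvalue_ge_of_certificate (LiebThm1.hamiltonian_isHermitian G t U) hψ1 hHψ hΛ O s X s'
    Y (fun _ => totalNumberOp - (N : ℂ) • 1) (fun _ => totalNumberOp - (N : ℂ) • 1) Y'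
    (fun _ _ => totalNumberOp_sub_mulVec_of_isNParticle N hψN)
    (fun _ _ => by
      rw [conjTranspose_totalNumberOp_sub]; exact totalNumberOp_sub_mulVec_of_isNParticle N hψN)
    hcert

/-- The same certificate bounds the energy per site: `c/|Λ| ≤ energyPerSite G t U N`.
[cite: Han2020Bootstrap, §3] -/
theorem energyPerSite_ge_of_certificate (t U : ℝ) {N : ℕ} (hN : N ≤ 2 * Fintype.card Λ)
    [Nonempty Λ]
    {m : Type*} [Fintype m] [DecidableEq m] {Λm : Matrix m m ℂ} (hΛ : Λm.PosSemidef)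
    (O : m → Matrix (Finset (Orb Λ)) (Finset (Orb Λ)) ℂ)
    {κ : Type*} (s : Finset κ) (X : κ → Matrix (Finset (Orb Λ)) (Finset (Orb Λ)) ℂ)
    {κ' : Type*} (s' : Finset κ') (Y Y' : κ' → Matrix (Finset (Orb Λ)) (Finset (Orb Λ)) ℂ)
    {c : ℝ}
    (hcert : hamiltonian G t U - (c : ℂ) • (1 : Matrix (Finset (Orb Λ)) (Finset (Orb Λ)) ℂ) =
      gramForm Λm O + (∑ k ∈ s, (hamiltonian G t U * X k - X k * hamiltonian G t U) +
        ∑ l ∈ s', (Y l * (totalNumberOp - (N : ℂ) • 1) + (totalNumberOp - (N : ℂ) • 1) * Y' l))) :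
    c / Fintype.card Λ ≤ energyPerSite G t U N := by
  have h := groundEnergyAt_ge_of_certificate G t U hN hΛ O s X s' Y Y' hcert
  have hcard : (0 : ℝ) < Fintype.card Λ := by exact_mod_cast Fintype.card_pos
  unfold energyPerSite
  exact div_le_div_of_nonneg_right h hcard.le

end Certificate

end Literature.MathematicalPhysics.QuantumLattice
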